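import Summits.BirchSwinnertonDyer.BirchSwinnertonDyer.Theorems.CMKolyvaginAtInertTwoRationalDescentAtTwoLevelZero
import Summits.BirchSwinnertonDyer.BirchSwinnertonDyer.Theorems.CMKolyvaginAtInertTwoTauPartDescentAtTwoPrimeLevel
import HarnessLib

/-!
# Route `CMKolyvaginAtInertTwo`, crux `CMKolyvaginExactAtInertTwo` (stmt-BirchSwinnertonDyer-24277):
# the `M₀ = 0` case on H₂ for a prime Heegner field from PRIME-LEVEL point data only —
# `#Ш(E/K)[2^∞] = 1` modulo {one `PointSystem` with support `{ℓ}` per CM-inert Kolyvagin prime `ℓ`,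
# (tower), (desc-fin)}

Seat `bsd-line-cmk2-p1` g9 (cell `bsd-print-cf2`); helper (`--supports stmt-BirchSwinnertonDyer-24277`).
THEOREMS ONLY (no definition, no named fact, no instance, no `sorry`); no item is closed; BSD is not
proved by this.

WHY (as in `…TauPartDescentAtTwoPrimeLevel`): the over-`ℚ` bit of g8
(`KolyvaginRatDescentTwo.selmer_two_eq_zero_or_eq_kummer_of_hpoints`, p628469) takes the machine's
point-system binder with FULL support — one package whose Euler-system clauses are demanded at every
square-free product of Kolyvagin primes — but uses it at `m = 1` and at ONE prime `m = ℓ`. The open DATA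
item (0b)₂¹ of the pen's booking memo (`BOOKING-TARGET-H2-levelzero.md` v2 §2) is the prime-level datum:
for each CM-inert Kolyvagin prime `ℓ` of `(2, 1)` ty2's `PointSystem N_E W K P 2 (· = ℓ) 1 hdiv c`
(levels `m ∈ {1, ℓ}`). This file puts the whole `M₀ = 0` chain in that currency and discharges EVERY
other input that is a theorem of the tree:

* §1 `selmer_two_eq_zero_or_eq_kummer_of_hpoints_primeLevel` — g8's core re-proved with per-prime
  packages (the package is opened AFTER the Čebotarev choice of `ℓ`; `c(1) = δ₂ y_K` for every package).
* §2 `selmer_two_eq_zero_or_eq_kummer_of_cmInert_primeLevel_of_plumbing` — **ON H₂ with `K = ℚ(√−q)` a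
  prime Heegner field and a Heegner point `P ∉ 2E(K)` of level `N_E`: `Sel₂(E/K) ⊆ {0, δ₂ P}`** modulo
  EXACTLY {the per-prime DATA `D`, (tower), (desc-fin)}: `τ = 1` on `Sel₂` from this seat's
  `KolyvaginDescentTwo.conjAct_eq_self_of_cmInert_primeLevel_two` (reciprocity discharged, p634537),
  (inj) + (desc) from g8's `…InfRes` (`resTorsion_two_injective`, `exists_resTorsion_two_eq_of_conjAct_eq`),
  (lag) from g8's `…Count`/`…PrimeDiscr` (`ratDescent_lag_of_discr_eq_neg_prime`), (dual) from g8's second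
  bit `…Dual.ratDescent_dual_of_plumbing`, Poitou–Tate from the tree theorem
  `SchneiderFreeAdditiveX3.PoitouTateReduction.poitouTate_selmerStructure_duality_real_holds ℚ`, Tate's local
  Euler characteristic from `GaloisImage.EP.localEulerPoincareCharacteristic_adicCompletion`, the archimedean
  condition from `mem_selmerLocalKer_infinitePlace_of_Δ_neg`.
* §3 `natCard_primaryComponent_sha_two_eq_one_of_cmInert_primeLevel_of_plumbing` — hence
  **`#Ш(E/K)[2^∞] = 1`** modulo the same three inputs (`natCard_primaryComponent_sha_eq_one_of_selmer_subset_pair`,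
  p635044; `c ≠ 1` and the `2`-divisibility of `E(K̄)` supplied).

Beyond print: NO while `D` is a hypothesis. BSD is not proved by this.

References: [GrossLMS1991] Prop. 2.1 with §10, (4.4), Props. 5.3, 5.4, 6.2; [McCallumLMS1991] §1, §2
Prop. 2.2, §3 Cor. 3.2, §5 Lemma 5.1, 5.3; [MilneADT2006] I Thm. 2.8, Cor. 3.4, Thm. 4.10 (b);
[SilvermanAEC2009] X Thm. 4.2 (a); [Kolyvagin1989Izv] §3; `Cruxes/CMExactDescentAtTwo/MEMO-overQ-bit.md`.
-/

-- single-conjunct summit: `Summit.BirchSwinnertonDyer.BirchSwinnertonDyer.…` repeats the name by design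
set_option linter.dupNamespace false
set_option autoImplicit false

noncomputable section

open scoped Classical
open WeierstrassCurve NumberField IsDedekindDomain Field
open Literature.NumberTheory.GaloisRepresentations Literature.NumberTheory.EllipticCurves
open Literature.NumberTheory.GaloisCohomology
open Rat.HeightOneSpectrum (primesEquiv)

namespace Summit.BirchSwinnertonDyer.BirchSwinnertonDyer.Theorems.KolyvaginRatDescentTwo

-- `K : Type` (universe 0) as in the Čebotarev leaf at `2` (p597930) and the route items
variable (W : WeierstrassCurve ℚ) {K : Type} [Field K] [NumberField K]

/-! ## §1 `Sel₂(E/K) ⊆ {0, δ₂ y_K}` from PRIME-LEVEL packages, `τ = 1`, and the over-`ℚ` binders -/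

/-- **`y_K ∉ 2E(K)` ⟹ `Sel₂(E/K) ⊆ {0, δ₂ y_K}` — g8's `…_of_hpoints` with the point system demanded at
the PRIME levels only**: for every Kolyvagin prime `ℓ` of `(2, 1)` a package `hpoints ℓ` (Gross (4.4),
Props. 5.3, 5.4, 6.2 at `m ∈ {1, ℓ}`; ty2's `PointSystem … (· = ℓ) 1` in Prop shape); the other
binders (`hτ`, (inj), (desc), (dual), (lag)) as in g8. Level written `q` with `q = 2`.
[cite: GrossLMS1991, §10 and Props. 5.4 (2), 6.2] [cite: McCallumLMS1991, §2 Prop. 2.2, §3 Cor. 3.2]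
[cite: MilneADT2006, Ch. I, Thm. 4.10] -/
theorem selmer_two_eq_zero_or_eq_kummer_of_hpoints_primeLevel {N : ℕ} [NeZero N] [W.IsElliptic]
    (hK : IsImaginaryQuadratic K) (P : (W.baseChange K).toAffine.Point)
    (hρ : W.HasSurjectiveModNGaloisRep 2) (hΔ : W.Δ < 0) (hΔK : ¬ IsSquare (W.baseChange K).Δ)
    {c : K ≃ₐ[ℚ] K} (hc : c ≠ 1) (hy : ∀ Q : (W.baseChange K).toAffine.Point, 2 • Q ≠ P)
    {q : ℕ} (hq : q = 2)
    (hdiv : ∀ Q : geomPoints (W.baseChange K), ∃ R, (q : ℤ) • R = Q)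
    (hpoints : ∀ ⦃ℓ : ℕ⦄ (_ : IsKolyvaginPrime N W K 2 ℓ), FrobEqFrobInfty W K q ℓ →
      ∃ (ε : ℤ) (τ : AlgebraicClosure K ≃+* AlgebraicClosure K) (hτ : IsLiftOfAut c τ)
        (A : ℕ → AddSubgroup (geomPoints (W.baseChange K)))
        (hA : ∀ m, KolyvaginCocycle.IsAdmissible (Field.absoluteGaloisGroup K) (A m) (q : ℤ))
        (Pt : ℕ → geomPoints (W.baseChange K))
        (hPt : ∀ m, Pt m ∈ KolyvaginCocycle.invPoints (Field.absoluteGaloisGroup K) (A m) (q : ℤ)),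
        (ε = 1 ∨ ε = -1) ∧
        IsOfFinAddOrder (Affine.Point.map (W' := W) (c : K →ₐ[ℚ] K) P - ε • P) ∧
        (∀ m, ∀ a ∈ A m, hτ.pointsMap W a ∈ A m) ∧
        Pt 1 = toGeomPoints (W.baseChange K) P ∧
        (∀ m : ℕ, Squarefree m →
          (∀ q' ∈ m.primeFactors, IsKolyvaginPrime N W K 2 q' ∧ FrobEqFrobInfty W K q q' ∧ q' = ℓ) →
          (∃ B ∈ A m, hτ.pointsMap W (Pt m) =
            (ε * (-1) ^ m.primeFactors.card) • Pt m + (q : ℤ) • B) ∧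
          (∀ v : HeightOneSpectrum (𝓞 K), (m : 𝓞 K) ∉ v.asIdeal →
            kolyvaginClass (W.baseChange K) _ hdiv (hA m) (Pt m) (hPt m) ∈
              selmerLocalKer (W.baseChange K) (v.adicCompletion K) (q : ℤ)) ∧
          (∀ ℓ' : ℕ, ℓ'.Prime → ℓ' ∣ m → ∀ v : HeightOneSpectrum (𝓞 K), (ℓ' : 𝓞 K) ∈ v.asIdeal →
            ∀ a : ℕ, ((((2 : ℕ) : ℤ) ^ a) •
                kolyvaginClass (W.baseChange K) _ hdiv (hA m) (Pt m) (hPt m) ∈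
                selmerLocalKer (W.baseChange K) (v.adicCompletion K) (q : ℤ) ↔
              (((2 : ℕ) : ℤ) ^ a) • kolyvaginClass (W.baseChange K) _ hdiv (hA (m / ℓ')) (Pt (m / ℓ'))
                  (hPt (m / ℓ')) ∈
                (W.baseChange K).torsionLocalKer (v.adicCompletion K) (q : ℤ)))))
    (hτ : ∀ s ∈ selmerGroup (W.baseChange K) (q : ℤ), conjAct W c (q : ℤ) s = s)
    (hinj : Function.Injective (resTorsion W K (q : ℤ)))
    (u : HeightOneSpectrum (𝓞 ℚ))
    (hdesc : ∀ s ∈ selmerGroup (W.baseChange K) (q : ℤ), conjAct W c (q : ℤ) s = s →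
      ∃ ξ : galH1Torsion W (q : ℤ),
        ((∀ v : HeightOneSpectrum (𝓞 ℚ), v ≠ u → ξ ∈ selmerLocalKer W (v.adicCompletion ℚ) (q : ℤ)) ∧
          ∀ w : InfinitePlace ℚ, ξ ∈ selmerLocalKer W w.Completion (q : ℤ)) ∧
        resTorsion W K (q : ℤ) ξ = s)
    (hdual : ∀ {ℓ : ℕ} (hℓ : IsKolyvaginPrime N W K 2 ℓ), FrobEqFrobInfty W K q ℓ →
      ∀ d : galH1Torsion (W.baseChange K) (q : ℤ), conjAct W c (q : ℤ) d = d →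
      (∀ v : HeightOneSpectrum (𝓞 K), (ℓ : 𝓞 K) ∉ v.asIdeal →
        d ∈ selmerLocalKer (W.baseChange K) (v.adicCompletion K) (q : ℤ)) →
      (∀ w : InfinitePlace K, d ∈ selmerLocalKer (W.baseChange K) w.Completion (q : ℤ)) →
      d ∉ selmerLocalKer (W.baseChange K) (hℓ.place.adicCompletion K) (q : ℤ) →
      ∀ ξ : galH1Torsion W (q : ℤ),
      ((∀ v : HeightOneSpectrum (𝓞 ℚ), v ≠ u → ξ ∈ selmerLocalKer W (v.adicCompletion ℚ) (q : ℤ)) ∧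
          ∀ w : InfinitePlace ℚ, ξ ∈ selmerLocalKer W w.Completion (q : ℤ)) →
      ξ ∈ W.torsionLocalKer (u.adicCompletion ℚ) (q : ℤ) →
      resTorsion W K (q : ℤ) ξ ∈ (W.baseChange K).torsionLocalKer (hℓ.place.adicCompletion K) (q : ℤ))
    (hlag : ∀ ξ₁ ξ₂ : galH1Torsion W (q : ℤ),
      ((∀ v : HeightOneSpectrum (𝓞 ℚ), v ≠ u → ξ₁ ∈ selmerLocalKer W (v.adicCompletion ℚ) (q : ℤ)) ∧
          ∀ w : InfinitePlace ℚ, ξ₁ ∈ selmerLocalKer W w.Completion (q : ℤ)) →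
      ((∀ v : HeightOneSpectrum (𝓞 ℚ), v ≠ u → ξ₂ ∈ selmerLocalKer W (v.adicCompletion ℚ) (q : ℤ)) ∧
          ∀ w : InfinitePlace ℚ, ξ₂ ∈ selmerLocalKer W w.Completion (q : ℤ)) →
      ξ₁ ∉ W.torsionLocalKer (u.adicCompletion ℚ) (q : ℤ) →
      ξ₂ ∉ W.torsionLocalKer (u.adicCompletion ℚ) (q : ℤ) →
      ξ₁ - ξ₂ ∈ W.torsionLocalKer (u.adicCompletion ℚ) (q : ℤ)) :
    ∀ s ∈ selmerGroup (W.baseChange K) (q : ℤ),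
      s = 0 ∨ s = kummerMapTorsion (W.baseChange K) (q : ℤ) hdiv P := by
  subst hq
  classical
  haveI : Fact (Nat.Prime 2) := ⟨Nat.prime_two⟩
  haveI : Algebra.IsQuadraticExtension ℚ K := ⟨hK.1⟩
  haveI : IsTotallyComplex K := hK.2
  -- ### `2 · H¹(K, E₂) = 0`
  have h2 : ∀ z : galH1Torsion (W.baseChange K) (((2 : ℕ) : ℕ) : ℤ), z + z = 0 := fun z ↦ by
    have h : (2 : ℤ) • z = 0 := zsmul_galH1Torsion_eq_zero (W.baseChange K) _ z
    rwa [two_zsmul] at h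
  have hneg : ∀ z : galH1Torsion (W.baseChange K) (((2 : ℕ) : ℕ) : ℤ), -z = z := fun z ↦
    neg_eq_of_add_eq_zero_left (h2 z)
  -- ### `x_K = δ₂ y_K ≠ 0` (as `y_K ∉ 2E(K)`), Selmer, `τ`-invariant
  set xK : galH1Torsion (W.baseChange K) (((2 : ℕ) : ℕ) : ℤ) := kummerMapTorsion (W.baseChange K) _ hdiv P
    with hxK_def
  have hx0 : xK ≠ 0 := by
    intro h0
    have hker : P ∈ (kummerMapTorsion (W.baseChange K) _ hdiv).ker := by
      rw [AddMonoidHom.mem_ker, ← hxK_def, h0]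
    rw [kummerMapTorsion_ker, AddMonoidHom.mem_range] at hker
    obtain ⟨R, hR⟩ := hker
    refine hy R ?_
    have hR' : (((2 : ℕ) : ℕ) : ℤ) • R = P := hR
    rwa [natCast_zsmul] at hR'
  have hxS : xK ∈ selmerGroup (W.baseChange K) (((2 : ℕ) : ℕ) : ℤ) :=
    (mem_selmerGroup_iff (W.baseChange K) _ _).mpr
      ⟨fun v ↦ kummerMapTorsion_mem_selmerLocalKer (W.baseChange K) _ hdiv (v.adicCompletion K) P,
        fun w ↦ kummerMapTorsion_mem_selmerLocalKer (W.baseChange K) _ hdiv w.Completion P⟩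
  have hx1 : conjAct W c _ xK = xK := hτ _ hxS
  -- ### the descent `x` of `δ₂ y_K`
  obtain ⟨x, hxrel, hxres⟩ := hdesc _ hxS hx1
  have hxne : x ≠ 0 := by
    rintro rfl
    exact hx0 (by rw [← hxres, map_zero])
  -- ### restricted classes are `τ`-invariant
  have hτres : ∀ ξ : galH1Torsion W (((2 : ℕ) : ℕ) : ℤ),
      conjAct W c _ (resTorsion W K _ ξ) = resTorsion W K _ ξ := fun ξ ↦
    conjAct_resTorsion K W _ c hK.1 hc ξ
  -- ### STEP 1: relaxed classes strict at `u` vanish (Čebotarev + the package AT `ℓ` + (dual))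
  have hstrict : ∀ ξ : galH1Torsion W (((2 : ℕ) : ℕ) : ℤ),
      ((∀ v : HeightOneSpectrum (𝓞 ℚ), v ≠ u → ξ ∈ selmerLocalKer W (v.adicCompletion ℚ) _) ∧
          ∀ w : InfinitePlace ℚ, ξ ∈ selmerLocalKer W w.Completion _) →
      ξ ∈ W.torsionLocalKer (u.adicCompletion ℚ) _ → ξ = 0 := by
    intro ξ hξrel hξu
    by_contra hξ0
    have hrξ0 : resTorsion W K _ ξ ≠ 0 := by
      intro h
      exact hξ0 (hinj (by rw [h, map_zero]))
    -- Čebotarev at `2`: a Kolyvagin prime `ℓ` with `(res ξ)_λ ≠ 0` and `x_λ ≠ 0`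
    have hC := Literature.NumberTheory.Automorphic.chebotarev_artinRep_holds
    obtain ⟨ℓ, hℓK, hux⟩ : ∃ ℓ : ℕ, IsKolyvaginPrime N W K 2 ℓ ∧
        ∀ v : HeightOneSpectrum (𝓞 K), (ℓ : 𝓞 K) ∈ v.asIdeal →
          resTorsion W K _ ξ ∉
              (W.baseChange K).torsionLocalKer (v.adicCompletion K) (((2 : ℕ) : ℕ) : ℤ) ∧
            xK ∉ (W.baseChange K).torsionLocalKer (v.adicCompletion K) (((2 : ℕ) : ℕ) : ℤ) := by
      by_cases hux : resTorsion W K _ ξ = xK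
      · obtain ⟨ℓ, -, hℓ, hℓN, hℓD, hℓ2, hprime, hfrob, hloc⟩ :=
          KolyvaginImageTwo.exists_kolyvaginPrime_gt_two hC (N := N) W hK hρ hΔ hΔK hc ![xK]
            (fun i ↦ by fin_cases i; exact hx1) (fun _ ↦ 1) (fun _ ↦ le_rfl)
            (KolyvaginDescentTwo.dvd_two_of_sum_one h2 hx0) 0
        refine ⟨ℓ, ⟨hℓ, hℓN, hℓD, hℓ2, hprime, hfrob⟩, fun v hv ↦ ?_⟩
        have h1 := hloc 0 v hv
        simp only [Matrix.cons_val_zero, one_ne_zero, iff_false] at h1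
        exact ⟨hux ▸ h1, h1⟩
      · obtain ⟨ℓ, -, hℓ, hℓN, hℓD, hℓ2, hprime, hfrob, hloc⟩ :=
          KolyvaginImageTwo.exists_kolyvaginPrime_gt_two hC (N := N) W hK hρ hΔ hΔK hc
            ![resTorsion W K _ ξ, xK]
            (fun i ↦ by fin_cases i; exacts [hτres ξ, hx1]) (fun _ ↦ 1) (fun _ ↦ le_rfl)
            (KolyvaginDescentTwo.dvd_two_of_sum_two h2 hrξ0 hx0 hux) 0
        refine ⟨ℓ, ⟨hℓ, hℓN, hℓD, hℓ2, hprime, hfrob⟩, fun v hv ↦ ?_⟩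
        have h0 := hloc 0 v hv
        have h1 := hloc 1 v hv
        simp only [Matrix.cons_val_zero, Matrix.cons_val_one, one_ne_zero, iff_false] at h0 h1
        exact ⟨h0, h1⟩
    have hfrob1 : FrobEqFrobInfty W K 2 ℓ := hℓK.2.2.2.2.2
    have hℓprime : ℓ.Prime := hℓK.prime
    -- THE PACKAGE AT `ℓ`: the classes `c(m)` from its points, `c(1) = δ₂ y_K`
    obtain ⟨ε, τ, hτl, A, hA, Pt, hPt, hε, -, hAτ, hPt1, hrel⟩ := hpoints hℓK hfrob1
    obtain ⟨cl, hcl⟩ : ∃ cl : ℕ → galH1Torsion (W.baseChange K) (((2 : ℕ) : ℕ) : ℤ),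
        ∀ m, cl m = kolyvaginClass (W.baseChange K) _ hdiv (hA m) (Pt m) (hPt m) := ⟨_, fun _ ↦ rfl⟩
    have hP1 : toGeomPoints (W.baseChange K) P ∈
        KolyvaginCocycle.invPoints (Field.absoluteGaloisGroup K) (A 1) (((2 : ℕ) : ℕ) : ℤ) := by
      rw [← hPt1]; exact hPt 1
    have hc1 : cl 1 = xK := by
      rw [hcl 1, KolyvaginDescent.kolyvaginClass_congr_point (hA 1) (hP' := hP1) hPt1]
      exact kolyvaginClass_toGeomPoints (hA 1) P hP1
    -- Kolyvagin's class `d = c(ℓ)`: `τ`-invariant, Selmer off `ℓ` and at `∞`, NOT Selmer at `λ`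
    have hkol : ∀ q' ∈ ℓ.primeFactors,
        IsKolyvaginPrime N W K 2 q' ∧ FrobEqFrobInfty W K 2 q' ∧ q' = ℓ := by
      intro q' hq'
      rw [hℓprime.primeFactors, Finset.mem_singleton] at hq'
      subst hq'
      exact ⟨hℓK, hfrob1, rfl⟩
    obtain ⟨h541, hdsel, hdloc⟩ := hrel ℓ hℓprime.squarefree hkol
    have hdeig : conjAct W c _ (cl ℓ) = cl ℓ := by
      have h := conjAct_kolyvaginClass_eq_smul W (hdiv := hdiv) hτl (hA ℓ) (hAτ ℓ) (hPt ℓ) _ h541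
      rw [← hcl ℓ, hℓprime.primeFactors, Finset.card_singleton, pow_one, mul_neg_one] at h
      rcases hε with rfl | rfl
      · rwa [neg_one_zsmul, hneg] at h
      · rwa [neg_neg, one_smul] at h
    have hdsel' : ∀ v : HeightOneSpectrum (𝓞 K), (ℓ : 𝓞 K) ∉ v.asIdeal →
        cl ℓ ∈ selmerLocalKer (W.baseChange K) (v.adicCompletion K) (((2 : ℕ) : ℕ) : ℤ) :=
      fun v hv ↦ by rw [hcl ℓ]; exact hdsel v hv
    have hdloc' : cl ℓ ∈ selmerLocalKer (W.baseChange K) (hℓK.place.adicCompletion K)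
          (((2 : ℕ) : ℕ) : ℤ) ↔
        cl (ℓ / ℓ) ∈ (W.baseChange K).torsionLocalKer (hℓK.place.adicCompletion K)
          (((2 : ℕ) : ℕ) : ℤ) := by
      have h := hdloc ℓ hℓprime dvd_rfl hℓK.place hℓK.mem_place 0
      rw [pow_zero, one_smul, one_smul, ← hcl ℓ, ← hcl (ℓ / ℓ)] at h
      exact h
    rw [Nat.div_self hℓprime.pos, hc1] at hdloc'
    have hdv : cl ℓ ∉ selmerLocalKer (W.baseChange K) (hℓK.place.adicCompletion K)
        (((2 : ℕ) : ℕ) : ℤ) :=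
      fun hmem ↦ (hux hℓK.place hℓK.mem_place).2 (hdloc'.mp hmem)
    have hdinf : ∀ w : InfinitePlace K,
        cl ℓ ∈ selmerLocalKer (W.baseChange K) w.Completion (((2 : ℕ) : ℕ) : ℤ) := fun w ↦ by
      haveI : IsAlgClosed w.Completion := isAlgClosed_of_ringEquiv
        (InfinitePlace.Completion.ringEquivComplexOfIsComplex (IsTotallyComplex.isComplex w)).symm
      rw [WeierstrassCurve.selmerLocalKer_eq_top_of_isAlgClosed]
      trivial
    -- (dual): `(res ξ)_λ = 0` — contradiction with the choice of `ℓ`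
    exact (hux hℓK.place hℓK.mem_place).1
      (hdual hℓK hfrob1 (cl ℓ) hdeig hdsel' hdinf hdv ξ hξrel hξu)
  -- ### STEP 2: `x` is not strict at `u`; a relaxed class is `0` or `x` (by (lag))
  have hxu : x ∉ W.torsionLocalKer (u.adicCompletion ℚ) _ := fun h ↦ hxne (hstrict x hxrel h)
  have hrelsub : ∀ ξ₁ ξ₂ : galH1Torsion W (((2 : ℕ) : ℕ) : ℤ),
      ((∀ v : HeightOneSpectrum (𝓞 ℚ), v ≠ u → ξ₁ ∈ selmerLocalKer W (v.adicCompletion ℚ) _) ∧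
          ∀ w : InfinitePlace ℚ, ξ₁ ∈ selmerLocalKer W w.Completion _) →
      ((∀ v : HeightOneSpectrum (𝓞 ℚ), v ≠ u → ξ₂ ∈ selmerLocalKer W (v.adicCompletion ℚ) _) ∧
          ∀ w : InfinitePlace ℚ, ξ₂ ∈ selmerLocalKer W w.Completion _) →
      ((∀ v : HeightOneSpectrum (𝓞 ℚ), v ≠ u → ξ₁ - ξ₂ ∈ selmerLocalKer W (v.adicCompletion ℚ) _) ∧
          ∀ w : InfinitePlace ℚ, ξ₁ - ξ₂ ∈ selmerLocalKer W w.Completion _) :=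
    fun ξ₁ ξ₂ h₁ h₂ ↦ ⟨fun v hv ↦ AddSubgroup.sub_mem _ (h₁.1 v hv) (h₂.1 v hv),
      fun w ↦ AddSubgroup.sub_mem _ (h₁.2 w) (h₂.2 w)⟩
  -- ### conclusion
  intro s hs
  obtain ⟨ξ, hξrel, hξres⟩ := hdesc s hs (hτ s hs)
  by_cases hξu : ξ ∈ W.torsionLocalKer (u.adicCompletion ℚ) _
  · left
    rw [← hξres, hstrict ξ hξrel hξu, map_zero]
  · right
    have h0 : ξ - x = 0 := hstrict (ξ - x) (hrelsub ξ x hξrel hxrel) (hlag ξ x hξrel hxrel hξu hxu)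
    rw [← hξres, sub_eq_zero.mp h0, hxres]

/-! ## §2 ON H₂ with a prime Heegner field: everything but {per-prime `D`, (tower), (desc-fin)} discharged -/

/-- **ON H₂ with `K = ℚ(√−q)` a prime Heegner field: a Heegner point `P ∉ 2E(K)` of level `N_E` forces
`Sel₂(E/K) ⊆ {0, δ₂ P}` — modulo EXACTLY the prime-level point DATA `D` (one ty2 `PointSystem` with
support `{ℓ}` per CM-inert Kolyvagin prime `ℓ` of `(2, 1)`) and the two PLUMBING binders (tower),
(desc-fin).** All other inputs are theorems of the tree (module docstring).
[cite: GrossLMS1991, Prop. 2.1 with §10, Props. 5.4, 6.2] [cite: McCallumLMS1991, §2 Prop. 2.2, §3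
Cor. 3.2, §5 Lemma 5.3] [cite: MilneADT2006, Ch. I, Thm. 2.8, Cor. 3.4 and Thm. 4.10] -/
theorem selmer_two_eq_zero_or_eq_kummer_of_cmInert_primeLevel_of_plumbing [W.IsElliptic]
    [W.IsGloballyMinimal] [NeZero (W.conductorNorm ℤ)] (hCM : W.HasCM)
    (hin : Literature.NumberTheory.EllipticCurves.Rank1Residual.CMInert W 2)
    (hsurj : W.HasSurjectiveModNGaloisRep 2) (hK : IsImaginaryQuadratic K) (hodd : Odd (discr K))
    (hH : SatisfiesHeegnerHypothesis (W.conductorNorm ℤ) K) {q : ℕ} (hq : q.Prime)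
    (hd : discr K = -(q : ℤ)) (u : HeightOneSpectrum (𝓞 ℚ)) (hu : ((primesEquiv u : Nat.Primes) : ℕ) = q)
    {P : (W.baseChange K).toAffine.Point} (hP : IsHeegnerPoint (W.conductorNorm ℤ) W K P)
    {c : K ≃ₐ[ℚ] K} (hc : c ≠ 1) (hy : ∀ Q : (W.baseChange K).toAffine.Point, 2 • Q ≠ P)
    (hdiv : ∀ Q : geomPoints (W.baseChange K), ∃ R, ((2 ^ 1 : ℕ) : ℤ) • R = Q)
    (D : ∀ ⦃ℓ : ℕ⦄ (_ : IsKolyvaginPrime (W.conductorNorm ℤ) W K 2 ℓ), FrobEqFrobInfty W K (2 ^ 1) ℓ →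
      Literature.NumberTheory.EllipticCurves.Rank1Residual.CMInert W ℓ →
      ∀ hdiv' : ∀ Q : geomPoints (W.baseChange K), ∃ R, ((2 ^ 1 : ℕ) : ℤ) • R = Q,
      Rank1Residual.P2.KolyvaginMachine.PointSystem (W.conductorNorm ℤ) W K P 2 (fun q' ↦ q' = ℓ) 1
        hdiv' c)
    (htower : ∀ (w : HeightOneSpectrum (𝓞 K)) (ξ : galH1Torsion W ((2 ^ 1 : ℕ) : ℤ)),
      ξ ∈ W.torsionLocalKer ((w.under (𝓞 ℚ)).adicCompletion ℚ) ((2 ^ 1 : ℕ) : ℤ) →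
        resTorsion W K ((2 ^ 1 : ℕ) : ℤ) ξ ∈
          (W.baseChange K).torsionLocalKer (w.adicCompletion K) ((2 ^ 1 : ℕ) : ℤ))
    (hdescfin : ∀ (ξ : galH1Torsion W ((2 ^ 1 : ℕ) : ℤ)) (v : HeightOneSpectrum (𝓞 ℚ)), v ≠ u →
      (∀ w : HeightOneSpectrum (𝓞 K), w.under (𝓞 ℚ) = v →
        resTorsion W K ((2 ^ 1 : ℕ) : ℤ) ξ ∈
          selmerLocalKer (W.baseChange K) (w.adicCompletion K) ((2 ^ 1 : ℕ) : ℤ)) →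
      ξ ∈ selmerLocalKer W (v.adicCompletion ℚ) ((2 ^ 1 : ℕ) : ℤ)) :
    ∀ s ∈ selmerGroup (W.baseChange K) ((2 ^ 1 : ℕ) : ℤ),
      s = 0 ∨ s = kummerMapTorsion (W.baseChange K) ((2 ^ 1 : ℕ) : ℤ) hdiv P := by
  have hΔ : W.Δ < 0 := KolyvaginEigenTwo.Δ_neg_of_cmInert_two W hCM hin hsurj
  have hΔK : ¬ IsSquare (W.baseChange K).Δ := by
    have h : (W.baseChange K).Δ = algebraMap ℚ K W.Δ := by rw [baseChange, map_Δ]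
    rw [h]
    exact KolyvaginImageTwo.not_isSquare_algebraMap_Δ_of_cmInert_two_of_heegner W hCM hin hsurj K hK hH
  -- Poitou–Tate over `ℚ` and Tate's local Euler–Poincaré characteristic are THEOREMS of the tree
  have hPT : poitouTate_selmerStructure_duality_real ℚ :=
    SchneiderFreeAdditiveX3.PoitouTateReduction.poitouTate_selmerStructure_duality_real_holds ℚ
  have hEP : ∀ v : HeightOneSpectrum (𝓞 ℚ), localEulerPoincareCharacteristic (v.adicCompletion ℚ) :=
    fun v ↦ Rank1Residual.GaloisImage.EP.localEulerPoincareCharacteristic_adicCompletion ℚ v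
  -- `τ = 1` on `Sel₂(E/K)` from the prime-level data alone (reciprocity discharged)
  have hτ := KolyvaginDescentTwo.conjAct_eq_self_of_cmInert_primeLevel_two W hCM hin hsurj hK hH hP hc hy D
  -- (inj), (desc)
  have hinj : Function.Injective (resTorsion W K ((2 ^ 1 : ℕ) : ℤ)) :=
    resTorsion_two_injective K W hsurj hK hc
  have hdesc : ∀ s ∈ selmerGroup (W.baseChange K) ((2 ^ 1 : ℕ) : ℤ),
      conjAct W c ((2 ^ 1 : ℕ) : ℤ) s = s → ∃ ξ : galH1Torsion W ((2 ^ 1 : ℕ) : ℤ),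
        ((∀ v : HeightOneSpectrum (𝓞 ℚ), v ≠ u →
            ξ ∈ selmerLocalKer W (v.adicCompletion ℚ) ((2 ^ 1 : ℕ) : ℤ)) ∧
          ∀ w : InfinitePlace ℚ, ξ ∈ selmerLocalKer W w.Completion ((2 ^ 1 : ℕ) : ℤ)) ∧
        resTorsion W K ((2 ^ 1 : ℕ) : ℤ) ξ = s := by
    intro s hs hτs
    obtain ⟨ξ, hξ⟩ : ∃ ξ : galH1Torsion W ((2 ^ 1 : ℕ) : ℤ), resTorsion W K ((2 ^ 1 : ℕ) : ℤ) ξ = s :=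
      exists_resTorsion_two_eq_of_conjAct_eq K W hsurj hK hc hτs
    refine ⟨ξ, ⟨fun v hv ↦ hdescfin ξ v hv fun w _ ↦ ?_,
      fun w ↦ mem_selmerLocalKer_infinitePlace_of_Δ_neg W hΔ w ξ⟩, hξ⟩
    rw [hξ]
    exact ((mem_selmerGroup_iff (W.baseChange K) _ s).mp hs).1 w
  -- (lag); (dual) = g8's second bit with the plumbing binders
  have hlag := ratDescent_lag_of_discr_eq_neg_prime W u hPT hEP hΔ hK hodd hH hq hd hu
  refine selmer_two_eq_zero_or_eq_kummer_of_hpoints_primeLevel W hK P hsurj hΔ hΔK hc hy (q := 2 ^ 1)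
    (pow_one 2) hdiv ?_ hτ hinj u hdesc
    (ratDescent_dual_of_plumbing W hsurj hΔ hK hc hPT hEP hd u hu htower hdescfin) hlag
  intro ℓ hℓ hF
  set D' := D hℓ hF (KolyvaginDescentTwo.cmInert_of_isKolyvaginPrime_two W hCM hin hsurj hℓ) hdiv
  exact ⟨D'.ε, D'.τ, D'.hτ, D'.A, D'.hA, D'.Pt, D'.hPt, D'.hε, D'.conj_sub_torsion, D'.A_stable,
    D'.Pt_one, D'.rel⟩

/-! ## §3 … hence `#Ш(E/K)[2^∞] = 1` -/

/-- **THE `M₀ = 0` CASE OF THE CRUX ON H₂ FOR A PRIME HEEGNER FIELD from PRIME-LEVEL DATA**: with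
`W`, `K = ℚ(√−q)`, a Heegner point `P ∉ 2E(K)` of level `N_E` as in §2, GRANTED the prime-level point
DATA `D` (∀ CM-inert Kolyvagin `ℓ`, ∀ `hdiv`, ∀ conjugation `c ≠ 1`: a ty2 `PointSystem` with support
`{ℓ}` at level `2`) and the PLUMBING binders (tower), (desc-fin): **`#Ш(E/K)[2^∞] = 1`**.
[cite: GrossLMS1991, Prop. 2.1 with §10, Props. 5.4, 6.2] [cite: McCallumLMS1991, §1 Theorem, §2
Prop. 2.2, §5 Lemma 5.1 and 5.3] [cite: SilvermanAEC2009, X Thm. 4.2 (a)] -/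
theorem natCard_primaryComponent_sha_two_eq_one_of_cmInert_primeLevel_of_plumbing [W.IsElliptic]
    [W.IsGloballyMinimal] [NeZero (W.conductorNorm ℤ)] (hCM : W.HasCM)
    (hin : Literature.NumberTheory.EllipticCurves.Rank1Residual.CMInert W 2)
    (hsurj : W.HasSurjectiveModNGaloisRep 2) (hK : IsImaginaryQuadratic K) (hodd : Odd (discr K))
    (hH : SatisfiesHeegnerHypothesis (W.conductorNorm ℤ) K) {q : ℕ} (hq : q.Prime)
    (hd : discr K = -(q : ℤ)) (u : HeightOneSpectrum (𝓞 ℚ)) (hu : ((primesEquiv u : Nat.Primes) : ℕ) = q)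
    {P : (W.baseChange K).toAffine.Point} (hP : IsHeegnerPoint (W.conductorNorm ℤ) W K P)
    (hy : ∀ Q : (W.baseChange K).toAffine.Point, 2 • Q ≠ P)
    (D : ∀ ⦃ℓ : ℕ⦄ (_ : IsKolyvaginPrime (W.conductorNorm ℤ) W K 2 ℓ), FrobEqFrobInfty W K (2 ^ 1) ℓ →
      Literature.NumberTheory.EllipticCurves.Rank1Residual.CMInert W ℓ →
      ∀ (hdiv' : ∀ Q : geomPoints (W.baseChange K), ∃ R, ((2 ^ 1 : ℕ) : ℤ) • R = Q)
        (c : K ≃ₐ[ℚ] K), c ≠ 1 →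
      Rank1Residual.P2.KolyvaginMachine.PointSystem (W.conductorNorm ℤ) W K P 2 (fun q' ↦ q' = ℓ) 1
        hdiv' c)
    (htower : ∀ (w : HeightOneSpectrum (𝓞 K)) (ξ : galH1Torsion W ((2 ^ 1 : ℕ) : ℤ)),
      ξ ∈ W.torsionLocalKer ((w.under (𝓞 ℚ)).adicCompletion ℚ) ((2 ^ 1 : ℕ) : ℤ) →
        resTorsion W K ((2 ^ 1 : ℕ) : ℤ) ξ ∈
          (W.baseChange K).torsionLocalKer (w.adicCompletion K) ((2 ^ 1 : ℕ) : ℤ))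
    (hdescfin : ∀ (ξ : galH1Torsion W ((2 ^ 1 : ℕ) : ℤ)) (v : HeightOneSpectrum (𝓞 ℚ)), v ≠ u →
      (∀ w : HeightOneSpectrum (𝓞 K), w.under (𝓞 ℚ) = v →
        resTorsion W K ((2 ^ 1 : ℕ) : ℤ) ξ ∈
          selmerLocalKer (W.baseChange K) (w.adicCompletion K) ((2 ^ 1 : ℕ) : ℤ)) →
      ξ ∈ selmerLocalKer W (v.adicCompletion ℚ) ((2 ^ 1 : ℕ) : ℤ)) :
    Nat.card (AddCommGroup.primaryComponent (W.baseChange K).sha 2) = 1 := by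
  haveI : Fact (Nat.Prime 2) := ⟨Nat.prime_two⟩
  haveI hEK : (W.baseChange K).IsElliptic := inferInstanceAs (W.map (algebraMap ℚ K)).IsElliptic
  obtain ⟨c, hc, -⟩ := exists_conj_of_isImaginaryQuadratic (K := K) hK
  have hdiv : ∀ Q : geomPoints (W.baseChange K), ∃ R, ((2 ^ 1 : ℕ) : ℤ) • R = Q := fun Q ↦
    (W.baseChange K).zsmul_geomPoints_surjective_holds (n := ((2 ^ 1 : ℕ) : ℤ)) (by norm_num) Q
  exact natCard_primaryComponent_sha_eq_one_of_selmer_subset_pair (W.baseChange K) 2 hdiv P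
    (selmer_two_eq_zero_or_eq_kummer_of_cmInert_primeLevel_of_plumbing W hCM hin hsurj hK hodd hH hq hd u hu
      hP hc hy hdiv (fun _ hℓ hF hS hdiv' ↦ D hℓ hF hS hdiv' c hc) htower hdescfin)

end Summit.BirchSwinnertonDyer.BirchSwinnertonDyer.Theorems.KolyvaginRatDescentTwo

end
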